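import Literature.NumberTheory.ComplexMultiplication.CMOrderIdealPrescribedLocalComponents
import Literature.NumberTheory.ComplexMultiplication.CMTorusIsomorphismClassesMaximalEndomorphismRingCount
import HarnessLib

/-!
# Multiplicator rings are decided at the singular primes (MARSEGLIA 2025 THEOREM 4.4, eq. (4.3)): every over-order
# `T` of `R` has `T_𝔮 = R_𝔮` at the regular primes, so `(J:J) = R` as soon as `(J:J)_𝔭 = R_𝔭` at every `𝔭 ⊇ 𝔣`; with
# prescribed local components this is the bijection `W̄_𝒮(R) ≅ ∏_{𝔭 ∈ 𝒮₀} W̄(R + 𝔭^{n_𝔭}𝒪)`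

Family `hodge`, lane `lit-hodgefound` (Track 2 foundations library; seat p15, row g26-#13), topic
`Literature/NumberTheory/ComplexMultiplication`, namespace `Literature.NumberTheory.ComplexMultiplication.EndOrder` (the
order `𝔯 = endOrder ρ ⊆ 𝒪 = 𝓞_K`, any degree).  THEOREMS ONLY: no definition, no instance, no named fact (net
Literature debt `0`).  Vocabulary: `FractionalIdeal (endOrder ρ)⁰ K`, `(I:J) = I / J`, the maximal order as an idempotent
`M = MM ≠ 0` with `↑M = (algebraMap (𝓞 K) K).range`, over-orders `T = TT ≠ 0`, the conductor
`𝔣 = EndOrder.conductorIdeal ρ`, `R_𝔭 = Localization.subalgebra.ofField K 𝔭.primeCompl _`, `I_𝔭 = span R_𝔭 ↑I`;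
`𝒮₀` = the maximal ideals containing `𝔣`.

## Source, VERBATIM

S. Marseglia, *Local isomorphism classes of fractional ideals of orders in étale algebras*, J. Algebra 673 (2025)
77–102 [Marseglia2025LocalIsomorphism] (arXiv:2311.18571, held `paper:arxiv-2311.18571`, chunks p0008–p0009):
"Theorem 4.4. We have natural monoid isomorphisms `W_𝒮(R) ⟷ ∏_{𝔭 ∈ 𝒮₀} W(R + 𝔭^{n_𝔭}𝒪)` (4.2) inducing a
bijection `W̄_𝒮(R) ⟷ ∏_{𝔭 ∈ 𝒮₀} W̄(R + 𝔭^{n_𝔭}𝒪)`. (4.3)  Proof. … For the bijection in Equation (4.3), let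
`T = (J:J)` and assume that for every index `1 ≤ i ≤ n` we have `(I_i:I_i) = R + 𝔭_i^{n_{𝔭_i}}𝒪`. Then, by Lemma 4.1,
we have `T_{𝔭_i} = (I_i:I_i)_{𝔭_i} = R_{𝔭_i}` for every `1 ≤ i ≤ n`. Since we also have that `T_𝔮 = R_𝔮` for every
`𝔮 ∉ 𝒮₀` we conclude that `T = R`. Hence, `[J]_{𝒮₀}` is in `W̄_{𝒮₀}(R)`. □"
and §2 Lemma 2.2 (7), chunk p0005: "`𝔭` is not invertible if and only if `(R:𝒪) ⊆ 𝔭` if and only if `R_𝔭 ⊊ 𝒪_𝔭`."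

## What is formalised

* **`le_of_mul_self_eq_of_coe_eq_range`** (every over-order lies in `𝒪`), **`coeIdeal_conductorIdeal_eq_one_div`**
  (`↑𝔣 = (R:𝒪)` for any `ρ` — the `ρ`-general form of `CMTypeLattice.coe_conductorIdeal_eq_one_div`),
  **`span_coe_eq_span_one_of_coe_eq_range_of_not_conductorIdeal_le`** (`𝒪_𝔮 = R_𝔮` at a regular `𝔮 ⊉ 𝔣`,
  Lemma 2.2 (7)), **`span_coe_eq_span_one_of_mul_self_eq_of_not_conductorIdeal_le`** («`T_𝔮 = R_𝔮` for every
  `𝔮 ∉ 𝒮₀`», any over-order `T`).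
* **`div_self_eq_one_of_forall_conductorIdeal_le`** (`(J:J)_𝔭 = R_𝔭` for all `𝔭 ⊇ 𝔣` ⟹ `(J:J) = R`),
  **`div_self_eq_one_of_forall_span_coe_eq`** (THM. 4.4 (4.3): `J_𝔭 = (I_𝔭)_𝔭` with `(I_𝔭:I_𝔭)_𝔭 = R_𝔭` at every
  `𝔭 ⊇ 𝔣` ⟹ `(J:J) = R`), **`exists_div_self_eq_one_and_forall_span_coe_eq`** (with the eq. (4.1) construction of
  `CMOrderIdealPrescribedLocalComponents`: such a `J` exists — surjectivity in (4.3)).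
-/

open scoped nonZeroDivisors NumberField
open Module FractionalIdeal NumberField

namespace Literature.NumberTheory.ComplexMultiplication

namespace EndOrder

variable {K : Type} [Field K] [NumberField K]
variable {ι : Type} [Fintype ι] [DecidableEq ι] [Nonempty ι] {ρ : K →ₐ[ℚ] Matrix ι ι ℚ}
variable [IsFractionRing (endOrder ρ) K]

/-- **Every over-order lies in the maximal order: `TT = T ≠ 0 ⟹ T ⊆ 𝒪`** (an over-order is a subring of `K` module
finite over `ℤ`, hence integral). [cite: Marseglia2019, §2 («The set of orders in `K` contains a maximal element …
`𝒪_K`»), p. 4] [cite: Stevenhagen2008NumberRings, §6 Lemma 6.4, p. 222] -/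
theorem le_of_mul_self_eq_of_coe_eq_range {T M : FractionalIdeal (endOrder ρ)⁰ K} (hTT : T * T = T) (hT0 : T ≠ 0)
    (hMO : (M : Set K) = (algebraMap (𝓞 K) K).range) : T ≤ M := by
  obtain ⟨S, -, hfin, hS⟩ := (mul_self_eq_iff_exists_overorder hT0).1 hTT
  intro x hx
  have hxS : x ∈ S := by rw [← SetLike.mem_coe, hS]; exact hx
  have hxO : x ∈ (algebraMap (𝓞 K) K).range := le_range_of_moduleFinite hfin hxS
  rw [← FractionalIdeal.mem_coe, ← SetLike.mem_coe]
  change x ∈ (M : Set K)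
  rw [hMO]
  exact hxO

/-- **`↑𝔣 = (R:𝒪) = 1 / M`** as fractional `𝔯`-ideals, for every `ρ` (`𝔣 = {a : a𝒪 ⊆ R}`; the `ρ`-general form of
`CMTypeLattice.coe_conductorIdeal_eq_one_div`). [cite: Marseglia2025LocalIsomorphism, §2 («the conductor
`𝔣 = (R:𝒪)`»), p. 5] [cite: Stevenhagen2008NumberRings, §6 («the largest `𝒪`-ideal contained in `R`»), p. 224] -/
theorem coeIdeal_conductorIdeal_eq_one_div {M : FractionalIdeal (endOrder ρ)⁰ K} (hM0 : M ≠ 0)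
    (hMO : (M : Set K) = (algebraMap (𝓞 K) K).range) :
    (conductorIdeal ρ : FractionalIdeal (endOrder ρ)⁰ K) = 1 / M := by
  have hmem : ∀ m : K, m ∈ M ↔ ∃ y : 𝓞 K, (y : K) = m := fun m ↦ by
    rw [← FractionalIdeal.mem_coe, ← SetLike.mem_coe]
    change m ∈ (M : Set K) ↔ _
    rw [hMO]
    exact ⟨fun ⟨y, hy⟩ ↦ ⟨y, hy⟩, fun ⟨y, hy⟩ ↦ ⟨y, hy⟩⟩
  ext x
  rw [mem_coeIdeal, mem_div_iff_of_ne_zero hM0]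
  constructor
  · rintro ⟨r, hr, rfl⟩ m hm
    obtain ⟨y, rfl⟩ := (hmem m).1 hm
    exact (mem_one_iff _).2 ⟨⟨_, (mem_conductorIdeal_iff ρ).1 hr y⟩, rfl⟩
  · intro hx
    have h1 : x ∈ (1 : FractionalIdeal (endOrder ρ)⁰ K) := by
      have h := hx 1 ((hmem 1).2 ⟨1, by simp⟩)
      rwa [mul_one] at h
    obtain ⟨r, rfl⟩ := (mem_one_iff _).1 h1
    refine ⟨r, (mem_conductorIdeal_iff ρ).2 fun y ↦ ?_, rfl⟩
    obtain ⟨s, hs⟩ := (mem_one_iff _).1 (hx y ((hmem y).2 ⟨y, rfl⟩))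
    have : (r : K) * y = (s : K) := hs.symm
    rw [this]
    exact s.2

/-- **LEMMA 2.2 (7), regular half: `𝒪_𝔮 = R_𝔮` at every prime `𝔮 ⊉ 𝔣`** (`u ∈ 𝔣 ∖ 𝔮` is a unit of `R_𝔮` with
`u𝒪 ⊆ R`). [cite: Marseglia2025LocalIsomorphism, §2 Lemma 2.2 (7) («`𝔭` is not invertible iff `(R:𝒪) ⊆ 𝔭` iff
`R_𝔭 ⊊ 𝒪_𝔭`»), p. 5] [cite: Stevenhagen2008NumberRings, §6 («`𝔭` is regular ⟺ `R_𝔭 = 𝒪_𝔭` ⟺ `𝔭 ∤ 𝔣_R`»), p. 224] -/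
theorem span_coe_eq_span_one_of_coe_eq_range_of_not_conductorIdeal_le {M : FractionalIdeal (endOrder ρ)⁰ K}
    (hMO : (M : Set K) = (algebraMap (𝓞 K) K).range) {𝔮 : Ideal (endOrder ρ)} [h𝔮 : 𝔮.IsPrime]
    (hreg : ¬ conductorIdeal ρ ≤ 𝔮) :
    Submodule.span (Localization.subalgebra.ofField K 𝔮.primeCompl 𝔮.primeCompl_le_nonZeroDivisors) (M : Set K) =
      Submodule.span (Localization.subalgebra.ofField K 𝔮.primeCompl 𝔮.primeCompl_le_nonZeroDivisors) {1} := by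
  set A := Localization.subalgebra.ofField K 𝔮.primeCompl 𝔮.primeCompl_le_nonZeroDivisors with hA
  have hmem : ∀ m : K, m ∈ M ↔ ∃ y : 𝓞 K, (y : K) = m := fun m ↦ by
    rw [← FractionalIdeal.mem_coe, ← SetLike.mem_coe]
    change m ∈ (M : Set K) ↔ _
    rw [hMO]
    exact ⟨fun ⟨y, hy⟩ ↦ ⟨y, hy⟩, fun ⟨y, hy⟩ ↦ ⟨y, hy⟩⟩
  obtain ⟨u, hu𝔣, hu𝔮⟩ := Set.not_subset.1 hreg
  -- `u⁻¹ ∈ R_𝔮`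
  have huA : (algebraMap (endOrder ρ) K u)⁻¹ ∈ A := by
    have h1u : (1 : K) ∈ Submodule.span A ({algebraMap (endOrder ρ) K u} : Set K) := by
      rw [NumberRing.span_singleton_algebraMap_eq_span_one (K := K) hu𝔮]
      exact Submodule.mem_span_singleton_self _
    obtain ⟨a, ha⟩ := Submodule.mem_span_singleton.1 h1u
    rw [Subalgebra.smul_def, smul_eq_mul] at ha
    rw [inv_eq_of_mul_eq_one_left ha]
    exact a.2
  have hu0 : algebraMap (endOrder ρ) K u ≠ 0 := fun h0 ↦ hu𝔮 (by
    rw [(IsFractionRing.injective (endOrder ρ) K) (h0.trans (map_zero _).symm)]; exact 𝔮.zero_mem)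
  refine le_antisymm (Submodule.span_le.2 fun m hm ↦ ?_)
    (Submodule.span_mono (Set.singleton_subset_iff.2 ((hmem 1).2 ⟨1, by simp⟩)))
  -- `m = u⁻¹·(um)` with `um ∈ R`
  obtain ⟨y, rfl⟩ := (hmem m).1 hm
  have hum : (u : K) * y ∈ endOrder ρ := (mem_conductorIdeal_iff ρ).1 hu𝔣 y
  rw [SetLike.mem_coe, Submodule.mem_span_singleton]
  refine ⟨⟨(algebraMap (endOrder ρ) K u)⁻¹ * algebraMap (endOrder ρ) K ⟨_, hum⟩,
    mul_mem huA (A.algebraMap_mem _)⟩, ?_⟩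
  rw [Subalgebra.smul_def, smul_eq_mul, mul_one]
  change (algebraMap (endOrder ρ) K u)⁻¹ * ((u : K) * y) = (y : K)
  rw [← mul_assoc, show ((u : K)) = algebraMap (endOrder ρ) K u from rfl, inv_mul_cancel₀ hu0, one_mul]

/-- **«`T_𝔮 = R_𝔮` for every `𝔮 ∉ 𝒮₀`»: every over-order `T` of `R` is locally `R` at the regular primes**
(`R ⊆ T ⊆ 𝒪` and `𝒪_𝔮 = R_𝔮`). [cite: Marseglia2025LocalIsomorphism, §4, proof of Thm. 4.4 (eq. (4.3)), p. 9] -/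
theorem span_coe_eq_span_one_of_mul_self_eq_of_not_conductorIdeal_le {T : FractionalIdeal (endOrder ρ)⁰ K}
    (hTT : T * T = T) (hT0 : T ≠ 0) {𝔮 : Ideal (endOrder ρ)} [𝔮.IsPrime] (hreg : ¬ conductorIdeal ρ ≤ 𝔮) :
    Submodule.span (Localization.subalgebra.ofField K 𝔮.primeCompl 𝔮.primeCompl_le_nonZeroDivisors) (T : Set K) =
      Submodule.span (Localization.subalgebra.ofField K 𝔮.primeCompl 𝔮.primeCompl_le_nonZeroDivisors) {1} := by
  obtain ⟨M, hM0, hMM, hMO⟩ := exists_idempotent_coe_eq_range (ρ := ρ) (K := K)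
  refine le_antisymm ?_ (Submodule.span_mono (Set.singleton_subset_iff.2
    (FractionalIdeal.one_le.1 (one_le_of_mul_self_eq hTT hT0))))
  rw [← span_coe_eq_span_one_of_coe_eq_range_of_not_conductorIdeal_le hMO hreg]
  exact Submodule.span_mono fun x hx ↦ le_of_mul_self_eq_of_coe_eq_range hTT hT0 hMO hx

/-- **`(J:J)_𝔭 = R_𝔭` at every `𝔭 ⊇ 𝔣` ⟹ `(J:J) = R`** («Since we also have that `T_𝔮 = R_𝔮` for every `𝔮 ∉ 𝒮₀` we
conclude that `T = R`», `T = (J:J)`; by (4-3)). [cite: Marseglia2025LocalIsomorphism, §4, proof of Thm. 4.4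
(eq. (4.3)), p. 9] -/
theorem div_self_eq_one_of_forall_conductorIdeal_le {J : FractionalIdeal (endOrder ρ)⁰ K} (hJ : J ≠ 0)
    (h : ∀ 𝔭 : MaximalSpectrum (endOrder ρ), conductorIdeal ρ ≤ 𝔭.asIdeal →
      Submodule.span (Localization.subalgebra.ofField K 𝔭.asIdeal.primeCompl
          𝔭.asIdeal.primeCompl_le_nonZeroDivisors) ((J / J : FractionalIdeal (endOrder ρ)⁰ K) : Set K) =
        Submodule.span (Localization.subalgebra.ofField K 𝔭.asIdeal.primeCompl
          𝔭.asIdeal.primeCompl_le_nonZeroDivisors) {1}) :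
    J / J = 1 := by
  refine NumberRing.eq_one_of_forall_span_coe_eq_span_one fun 𝔭 ↦ ?_
  by_cases hle : conductorIdeal ρ ≤ 𝔭.asIdeal
  · exact h 𝔭 hle
  · haveI := 𝔭.isMaximal.isPrime
    exact span_coe_eq_span_one_of_mul_self_eq_of_not_conductorIdeal_le (div_self_mul_div_self hJ)
      (div_self_ne_zero hJ) hle

/-- **THEOREM 4.4, eq. (4.3): if `J_𝔭 = (I_𝔭)_𝔭` with `(I_𝔭:I_𝔭)_𝔭 = R_𝔭` at every maximal `𝔭 ⊇ 𝔣`, then `(J:J) = R`**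
(«`T_{𝔭_i} = (I_i:I_i)_{𝔭_i} = R_{𝔭_i}` … `T = R`. Hence, `[J]_{𝒮₀}` is in `W̄_{𝒮₀}(R)`»).
[cite: Marseglia2025LocalIsomorphism, §4 Thm. 4.4 (eq. (4.3)) and proof, pp. 8–9] -/
theorem div_self_eq_one_of_forall_span_coe_eq {J : FractionalIdeal (endOrder ρ)⁰ K} (hJ : J ≠ 0)
    (I : MaximalSpectrum (endOrder ρ) → FractionalIdeal (endOrder ρ)⁰ K)
    (h : ∀ 𝔭 : MaximalSpectrum (endOrder ρ), conductorIdeal ρ ≤ 𝔭.asIdeal → I 𝔭 ≠ 0 ∧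
      Submodule.span (Localization.subalgebra.ofField K 𝔭.asIdeal.primeCompl
          𝔭.asIdeal.primeCompl_le_nonZeroDivisors) (J : Set K) =
        Submodule.span (Localization.subalgebra.ofField K 𝔭.asIdeal.primeCompl
          𝔭.asIdeal.primeCompl_le_nonZeroDivisors) (I 𝔭 : Set K) ∧
      Submodule.span (Localization.subalgebra.ofField K 𝔭.asIdeal.primeCompl
          𝔭.asIdeal.primeCompl_le_nonZeroDivisors) ((I 𝔭 / I 𝔭 : FractionalIdeal (endOrder ρ)⁰ K) : Set K) =
        Submodule.span (Localization.subalgebra.ofField K 𝔭.asIdeal.primeCompl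
          𝔭.asIdeal.primeCompl_le_nonZeroDivisors) {1}) :
    J / J = 1 := by
  haveI := CMTypeLattice.isNoetherianRing_endOrder ρ
  refine div_self_eq_one_of_forall_conductorIdeal_le hJ fun 𝔭 hle ↦ ?_
  haveI := 𝔭.isMaximal.isPrime
  obtain ⟨hI0, hJI, hII⟩ := h 𝔭 hle
  rw [NumberRing.span_coe_div hJ, hJI, ← NumberRing.span_coe_div hI0, hII]

/-- **THEOREM 4.4, eq. (4.3), surjectivity: for nonzero `I_𝔭` with `(I_𝔭:I_𝔭)_𝔭 = R_𝔭` (`𝔭` ranging over a finite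
set `F ⊇ 𝒮₀`) there is ONE ideal `J` with multiplicator ring `R` and `J_𝔭 = (I_𝔭)_𝔭` at every `𝔭 ⊇ 𝔣`** (the
`J = Σ e_𝔭I_𝔭` of `CMOrderIdealPrescribedLocalComponents`). [cite: Marseglia2025LocalIsomorphism, §4 Thm. 4.4
(eq. (4.1)–(4.3)), pp. 8–9] -/
theorem exists_div_self_eq_one_and_forall_span_coe_eq (F : Finset (MaximalSpectrum (endOrder ρ)))
    (hF : ∀ 𝔭 : MaximalSpectrum (endOrder ρ), conductorIdeal ρ ≤ 𝔭.asIdeal → 𝔭 ∈ F)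
    (I : MaximalSpectrum (endOrder ρ) → FractionalIdeal (endOrder ρ)⁰ K) (hI : ∀ 𝔭 ∈ F, I 𝔭 ≠ 0)
    (hII : ∀ 𝔭 ∈ F,
      Submodule.span (Localization.subalgebra.ofField K 𝔭.asIdeal.primeCompl
          𝔭.asIdeal.primeCompl_le_nonZeroDivisors) ((I 𝔭 / I 𝔭 : FractionalIdeal (endOrder ρ)⁰ K) : Set K) =
        Submodule.span (Localization.subalgebra.ofField K 𝔭.asIdeal.primeCompl
          𝔭.asIdeal.primeCompl_le_nonZeroDivisors) {1}) :
    ∃ J : FractionalIdeal (endOrder ρ)⁰ K, J ≠ 0 ∧ J / J = 1 ∧ ∀ 𝔭 : MaximalSpectrum (endOrder ρ),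
      conductorIdeal ρ ≤ 𝔭.asIdeal →
        Submodule.span (Localization.subalgebra.ofField K 𝔭.asIdeal.primeCompl
            𝔭.asIdeal.primeCompl_le_nonZeroDivisors) (J : Set K) =
          Submodule.span (Localization.subalgebra.ofField K 𝔭.asIdeal.primeCompl
            𝔭.asIdeal.primeCompl_le_nonZeroDivisors) (I 𝔭 : Set K) := by
  obtain ⟨J, hJ0, hJ⟩ := exists_ne_zero_forall_span_coe_eq F I hI
  exact ⟨J, hJ0, div_self_eq_one_of_forall_span_coe_eq hJ0 I fun 𝔭 hle ↦
    ⟨hI 𝔭 (hF 𝔭 hle), hJ 𝔭 (hF 𝔭 hle), hII 𝔭 (hF 𝔭 hle)⟩, fun 𝔭 hle ↦ hJ 𝔭 (hF 𝔭 hle)⟩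

end EndOrder

end Literature.NumberTheory.ComplexMultiplication
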